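/-
Copyright (c) 2026 the pub-hodgecm-mathlib formalisation cell (harness21).  Prover seat hodgecm-mathlib-LH4-p05 (g8), Track A «(D-RAM) FOUR-FRAME» squad, helper lane on
h413 = stmt-HodgeConjecture-24833 (count-neutral).  β-TABLE lead (LEAD T20-15 close-out): the first TOWER-SIGN RELATION for F0P3a-p01 (g37)'s ODDBOX (T1)∕(T3) — equal-depth
towers of a deep isosceles key carry the same sign.  2026-09-04.
-/
import Summits.HodgeConjecture.HodgeConjecture.Theorems.F0P3cDyRamTowerSignToken                -- ★ p860771∕p860907 (this seat): the tokens; brings ★ №6, ★ `WildQuadraticDatumRefSkewScalar`, `…Trace`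
import Literature.NumberTheory.LocalFields.WildQuadraticDatumNormSignConductor                  -- ★ `normSign_eq_of_near` (units agreeing to conductor precision `2d − 1` have the same norm sign)
import HarnessLib

/-!
# Crux `H413`, line LH4 «(D-RAM) FOUR-FRAME» — TOWER-SIGN RELATIONS, I: two tower-sign tokens at the same depth whose elements agree to conductor precision have the
# same norm sign (`ω(e_B) = ω(e_A)` on an isosceles key `(m, m, L)` with `L − m ≥ 2d − 1`)

Cell `hodgecm-mathlib` (D-0151), FLOOR 0, crux item H413 = `stmt-HodgeConjecture-24833`, route `HCCMUnconditional`; squad F0∕P3c∕LH4.  THEOREMS ONLY (no `def`, no instance, no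
notation, no `sorry`, default heartbeats); ★-only imports; lane `--supports stmt-HodgeConjecture-24833 --as helper`; pays NO row, states NO law.

WHY (F0P3a-p01 (g37) ODDBOX-ORACLE v1 bdcd8809 §3).  The (β) table identity `OddLabelledBoxSum` is an identity in `(q, d, n, ω_A, ω_B, ω_C)`; the three tower signs are
NOT independent data: on the isosceles key `(n₁, n₂, n₃) = (m, m, L)` the tokens of the two depth-`m` towers are the `σ`-fixed units of `(α−1)·π^{−k}∕t₊` and `(β−1)·π^{−k}∕t₊`,
which differ by `(β−α)·π^{−k}∕t₊` of valuation `L − m`; by ★ `normSign_eq_of_near` they have the SAME norm sign as soon as `L − m ≥ 2d − 1` (the conductor precision = `m* − ℓ₀`).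
At `L − m ≤ 2d − 2` the relation is a genuine datum (forced `−` at `q = 2`, free at `q ≥ 4` — ORACLE §3, where the `H`-row pays the difference).  This file proves the deep case,
the hypothesis (T1) may therefore DROP for `s_g ≥ 2d − 1`.
* `normSign_towerSign_eq_of_sub_deep` — tokens `e` (of `α − 1`) and `e'` (of `β − 1`) at the same depth parameter `n ≡ d % 2`, `|β − α| ≤ |ϖ|^L`, `n + 2d ≤ L + 1` ⟹ `normSign σ e' = normSign σ e`.
HONEST LABEL.  Count-neutral arithmetic helper; table∕(β-BAL)∕(β)∕T₊ row OPEN; `HC_CM` is proved only modulo the 7 printed citations (2 remaining named inputs: hLiu418 =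
`stmt-HodgeConjecture-24832`, h413 = `stmt-HodgeConjecture-24833`) until rung 0 closes.

## References
* [Serre1979] J.-P. Serre, *Local Fields*, GTM 67 (1979), Ch. V §3 (conductor of a ramified quadratic extension; norm classes of units).
* [Rogawski1990] J. D. Rogawski, *Automorphic Representations of Unitary Groups in Three Variables*, Ann. of Math. Stud. 123 (1990), §4.9 p. 55.
-/

set_option autoImplicit false

noncomputable section

namespace Summit.HodgeConjecture.HodgeConjecture.Cruxes.H413.F0P3cDyRamTowerSignRelations

open Literature.NumberTheory.Automorphic Literature.NumberTheory.Automorphic.UnitaryThreeFourFrame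
open Literature.NumberTheory.LocalFields Literature.NumberTheory.LocalFields.WildQuadraticDatum
open Summit.HodgeConjecture.HodgeConjecture.Cruxes.H413.F0P3cDyRamFourFramePieces
open Summit.HodgeConjecture.HodgeConjecture.Cruxes.H413.F0P3cDyRamStageOneBDefs
open Summit.HodgeConjecture.HodgeConjecture.Cruxes.H413.F0P3cDyRamTowerSignToken
open WithZero
open scoped Valued

variable {K : Type} [Field K] [Valued K ℤᵐ⁰]

/-! ## §1  Equal-depth towers of a deep isosceles key carry the same sign -/

/-- **TOWER SIGNS AGREE ACROSS A DEEP ISOSCELES PAIR.**  At a ramified datum on a complete field, let `e`, `e'` be tower-sign tokens (σ-fixed units, `ϖ^{m*}`-congruence of §1)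
of `α − 1` and `β − 1` at the SAME depth parameter `n`, and suppose `|β − α| ≤ |ϖ|^L` with `n + (2d − 1) ≤ L`.  Then
`normSign σ e' = normSign σ e`: the two tokens differ by `(β − α)·π^{−(n−ℓ₀)∕2}∕t₊ + O(ϖ^{m* − ℓ₀})`, of valuation `≥ 2d − 1 =` the conductor precision (★ `normSign_eq_of_near`).
(The isosceles key `(m, m, L)` with `L − m ≥ 2d − 1`: the two equal-depth towers carry the SAME sign; at `L − m ≤ 2d − 2` the relation is a genuine datum — F0P3a-p01 (g37)
ODDBOX-ORACLE v1 §3.) [cite: Serre1979, Ch. V §3] [cite: Rogawski1990, §4.9 p. 55] -/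
theorem normSign_towerSign_eq_of_sub_deep [CompleteSpace K] {σ : K →+* K} {ϖ : K} {d t : ℕ} (hD : IsRamifiedQuadraticDatum σ ϖ d t)
    {α β : K} {n L : ℕ} (hvβα : Valued.v (β - α) ≤ Valued.v ϖ ^ L) (hL : n + 2 * d ≤ L + 1) (hpar : n % 2 = d % 2)
    {e e' : K} (hσe : σ e = e) (he1 : Valued.v e = 1) (hσe' : σ e' = e')
    (he : Valued.v ((ϖ ^ mstarOfRecord d)⁻¹ * ((α - 1) * ((ϖ * σ ϖ) ^ ((n - d % 2) / 2))⁻¹ - e * ((ϖ - σ ϖ) * ((ϖ * σ ϖ) ^ ((d - d % 2) / 2))⁻¹))) ≤ 1)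
    (he' : Valued.v ((ϖ ^ mstarOfRecord d)⁻¹ * ((β - 1) * ((ϖ * σ ϖ) ^ ((n - d % 2) / 2))⁻¹ - e' * ((ϖ - σ ϖ) * ((ϖ * σ ϖ) ^ ((d - d % 2) / 2))⁻¹))) ≤ 1) :
    normSign σ e' = normSign σ e := by
  obtain ⟨hσ, hvσ, hϖ, -, hd, h1d, -⟩ := id hD
  have hϖ0 : ϖ ≠ 0 := fun h => by rw [h, map_zero] at hϖ; exact (coe_ne_zero hϖ.symm).elim
  have hvϖ0 : Valued.v ϖ ≠ 0 := (Valuation.ne_zero_iff _).2 hϖ0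
  obtain ⟨k, hnk⟩ : ∃ k : ℕ, n = 2 * k + d % 2 := ⟨n / 2, by omega⟩
  have hk : (n - d % 2) / 2 = k := by omega
  rw [hk] at he he'
  set P : K := ((ϖ * σ ϖ) ^ k)⁻¹ with hPdef
  set tp : K := (ϖ - σ ϖ) * ((ϖ * σ ϖ) ^ ((d - d % 2) / 2))⁻¹ with htpdef
  set M : K := (ϖ ^ mstarOfRecord d)⁻¹ with hMdef
  have htp0 : tp ≠ 0 := refSkewScalar_ne_zero hvσ hϖ hd
  have hvtp : Valued.v tp = Valued.v ϖ ^ (d % 2) := by rw [htpdef, v_refSkewScalar hvσ hϖ hd, v_varpi_pow hϖ]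
  have hvP : Valued.v P = (Valued.v ϖ ^ (2 * k))⁻¹ := by rw [hPdef, map_inv₀, map_pow, map_mul, hvσ, ← pow_two, ← pow_mul]
  have hvM : Valued.v M = (Valued.v ϖ ^ mstarOfRecord d)⁻¹ := by rw [hMdef, map_inv₀, map_pow]
  -- `M·(e − e')·t₊ = −(M·((α−1)P − e·t₊)) + M·((β−1)P − e'·t₊) − M·(β−α)·P`
  have hid : M * ((e - e') * tp) = -(M * ((α - 1) * P - e * tp)) + M * ((β - 1) * P - e' * tp) - M * ((β - α) * P) := by ring
  -- the third term is small: `|M·(β−α)·P| ≤ |ϖ|^{L − 2k − m*}·` with `L − 2k ≥ m* − ℓ₀ + … `; we only need the total `≤ |ϖ|^{2d−1−…}`; work with the product by `t₊` and divide at the end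
  have h3 : Valued.v (M * ((β - α) * P)) ≤ Valued.v ϖ ^ (2 * d - 1 + d % 2) * (Valued.v ϖ ^ mstarOfRecord d)⁻¹ := by
    rw [map_mul, map_mul, hvM, hvP, mul_comm]
    have hL' : 2 * d - 1 + d % 2 + 2 * k ≤ L := by omega
    have hpow : Valued.v ϖ ^ L ≤ Valued.v ϖ ^ (2 * d - 1 + d % 2 + 2 * k) :=
      pow_le_pow_right_of_le_one' (le_of_lt (by rw [hϖ, ← exp_zero, exp_lt_exp]; norm_num)) hL'
    have hβα' : Valued.v (β - α) * (Valued.v ϖ ^ (2 * k))⁻¹ ≤ Valued.v ϖ ^ (2 * d - 1 + d % 2) := by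
      rw [mul_inv_le_iff₀ (pow_pos ((Valuation.pos_iff _).2 hϖ0) _), ← pow_add]
      exact hvβα.trans hpow
    exact mul_le_mul_left hβα' _
  have h12 : Valued.v (-(M * ((α - 1) * P - e * tp)) + M * ((β - 1) * P - e' * tp)) ≤ 1 := by
    refine (Valuation.map_add _ _ _).trans (max_le ?_ he')
    rw [Valuation.map_neg]; exact he
  -- hence `|M·(e−e')·t₊| ≤ max 1 (|ϖ|^{2d−1+ℓ₀}·|ϖ^{m*}|⁻¹) = |ϖ|^{2d−1+ℓ₀−m*}·… `; since `m* = ℓ₀ + 2d − 1` the second bound is exactly `1`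
  have hm : 2 * d - 1 + d % 2 = mstarOfRecord d := by unfold mstarOfRecord; omega
  have h3' : Valued.v (M * ((β - α) * P)) ≤ 1 := by
    refine h3.trans ?_
    rw [hm, mul_inv_cancel₀ (pow_ne_zero _ hvϖ0)]
  have htot : Valued.v (M * ((e - e') * tp)) ≤ 1 := by
    rw [hid]
    exact (Valuation.map_sub _ _ _).trans (max_le h12 h3')
  -- unfold: `|e − e'| ≤ |ϖ|^{m* − ℓ₀} = |ϖ|^{2d−1}`
  have hdiff : Valued.v (e - e') ≤ Valued.v ϖ ^ (2 * d - 1) := by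
    rw [map_mul, map_mul, hvM, hvtp] at htot
    have hpos : 0 < (Valued.v ϖ ^ mstarOfRecord d)⁻¹ := inv_pos.2 (pow_pos ((Valuation.pos_iff _).2 hϖ0) _)
    have := htot
    rw [mul_comm ((Valued.v ϖ ^ mstarOfRecord d)⁻¹), ← le_div_iff₀ hpos, div_inv_eq_mul, one_mul] at this
    -- `|e − e'|·|ϖ|^{ℓ₀} ≤ |ϖ|^{m*}`
    have hm' : mstarOfRecord d = (2 * d - 1) + d % 2 := by unfold mstarOfRecord; omega
    rw [hm', pow_add] at this
    exact le_of_mul_le_mul_right this (pow_pos ((Valuation.pos_iff _).2 hϖ0) _)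
  exact normSign_eq_of_near hD hσe hσe' he1 le_rfl hdiff

end Summit.HodgeConjecture.HodgeConjecture.Cruxes.H413.F0P3cDyRamTowerSignRelations

end
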